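import Summits.HubbardSuperconductivity.HubbardSuperconductivity.Theorems.AnisotropyChordTransferFibre3RowCGminTerms

/-!
# Route `AnisotropyChord` / H0 rotor rung: PartN41-C §2 — per-momentum bounds for the L-uniform G-min constant (shells and far rings)

The termwise majorants of `((4 − ε_k)/c₀)^{n₀} g_k` (GeomGMin, `n₀ ≥ V/3 − 1`) by class of the centred representative `m(k)`, in
the variables `θ = 2π/L`, `ν = λ₂/θ²` (`L ≥ 128`, `0 < ν ≤ 0.0513`): ★ `shell1_le` (`|m₁|+|m₂| = 1`, `ε = ε₁`:
`≤ 0.19325(1 + 1.784ν)/(0.9484θ²)`), ★ `shell2_le` (`|m₁| = |m₂| = 1`: `≤ 0.037341(1 + 1.784ν)/(1.9481θ²)`),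
★ `far_inner_le` (`4 ≤ |m|²`, `|mᵢ| ≤ L/8`: `≤ e^{−1.52|m|²}/(0.92717θ²|m|²)`), ★ `far_outer_le` (`289 ≤ |m|²`:
`≤ e^{−0.657|m|²}/(0.3998θ²|m|²)`), from `RowC.geom_term_le`, `RowC.eps1_ge_sharp`, `RowC.epsT_ge_inner`,
`RowC.epsT_ge_outer` and the exponential numerics of …RowCGminTerms.
Prover seat `hubbard-h0-rotor-p1` g27 (route lead); helper for stmt-HubbardSuperconductivity-23918 (`--supports`, helper class).
WHAT THIS IS NOT: nothing here proves superconductivity in the Hubbard model.  Tree imports only; no new definitions; no sorry.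
-/

set_option linter.dupNamespace false
set_option autoImplicit false

noncomputable section

open scoped BigOperators

namespace Summit.HubbardSuperconductivity.HubbardSuperconductivity.Theorems.AnisotropyChord.Transfer.Fibre3

namespace RowC

open RateLemma

/-- the common size facts at `L ≥ 128`: `Vθ² = 4π²`, `V ≥ 16384`, `θ² ≤ 0.0025`. [folklore] -/
theorem size_facts (L : ℕ) (hL : 128 ≤ L) :
    ((L : ℝ)) ^ 2 * (2 * Real.pi / L) ^ 2 = 4 * Real.pi ^ 2 ∧ (16384 : ℝ) ≤ ((L : ℝ)) ^ 2 ∧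
      (2 * Real.pi / (L : ℝ)) ^ 2 ≤ 0.0025 := by
  have hLpos : (0 : ℝ) < L := by exact_mod_cast (show 0 < L by omega)
  have hL128 : (128 : ℝ) ≤ L := by exact_mod_cast hL
  have hπ := Real.pi_lt_d2
  have hπ0 := Real.pi_pos
  refine ⟨by field_simp; ring, by nlinarith, ?_⟩
  have : 2 * Real.pi / (L : ℝ) ≤ 0.05 := by rw [div_le_iff₀ hLpos]; nlinarith
  have h0 : 0 ≤ 2 * Real.pi / (L : ℝ) := by positivity
  nlinarith

/-- `e^{1.645ν} ≤ 1 + 1.784ν` for `0 ≤ ν ≤ 0.0513`. [folklore] -/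
theorem exp_nu_le {ν : ℝ} (hν0 : 0 ≤ ν) (hν1 : ν ≤ 0.0513) : Real.exp (1.645 * ν) ≤ 1 + 1.784 * ν := by
  have h := exp_small_le (1.645 * ν) (by rw [abs_of_nonneg (by positivity)]; nlinarith)
  nlinarith

/-- the exponential factor of a shell: `e^{−x} ≤ e^{−a}·(1 + 1.784ν)` when `x ≥ a − 1.645ν`. [folklore] -/
theorem exp_shell_le {x a ν c : ℝ} (hx : a - 1.645 * ν ≤ x) (hν0 : 0 ≤ ν) (hν1 : ν ≤ 0.0513)
    (hc : Real.exp (-a) ≤ c) (hc0 : 0 ≤ c) : Real.exp (-x) ≤ c * (1 + 1.784 * ν) := by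
  calc Real.exp (-x) ≤ Real.exp (-a + 1.645 * ν) := Real.exp_le_exp.mpr (by linarith)
    _ = Real.exp (-a) * Real.exp (1.645 * ν) := by rw [← Real.exp_add]
    _ ≤ c * (1 + 1.784 * ν) := mul_le_mul hc (exp_nu_le hν0 hν1) (Real.exp_pos _).le hc0

/-- ★ SHELL 1 (`|m₁| + |m₂| = 1`, `ε = ε₁`). [folklore] -/
theorem shell1_le (L : ℕ) [NeZero L] (hL : 128 ≤ L) {lam2 ν : ℝ} (hl0 : 0 < lam2)
    (hνlam : lam2 = ν * (2 * Real.pi / L) ^ 2) (hν0 : 0 ≤ ν) (hν1 : ν ≤ 0.0513)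
    (n0 : ℕ) (hn0 : ((L : ℝ)) ^ 2 / 3 - 1 ≤ n0) {k : Tor L} (hk : k ≠ 0)
    (h1 : k.1.valMinAbs.natAbs + k.2.valMinAbs.natAbs = 1) :
    ((4 - epsT L k) / (4 - lam2 / 2)) ^ n0 * gres L lam2 k
      ≤ 0.19325 * (1 + 1.784 * ν) / (0.9484 * (2 * Real.pi / L) ^ 2) := by
  obtain ⟨hVθ, hV16, hθ2⟩ := size_facts L hL
  have hπ' := Real.pi_gt_d4
  have hε := eps1_ge_sharp L hL
  have hθpos : 0 < (2 * Real.pi / (L : ℝ)) ^ 2 := by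
    have : (0 : ℝ) < L := by exact_mod_cast (show 0 < L by omega)
    positivity
  have hl1 : lam2 ≤ 1 := by rw [hνlam]; nlinarith
  have hεk : epsT L k = eps1 L := epsT_shellOne L k h1
  have hEl : lam2 / 2 < eps1 L := by rw [hνlam]; nlinarith
  have hgt := geom_term_le L hl0 hl1 hk (eps1 L) hEl (le_of_eq hεk.symm) n0 _ hn0
  refine hgt.trans ?_
  have hnlo0 : 0 ≤ ((L : ℝ)) ^ 2 / 3 - 1 := by linarith
  -- exponent ≥ 1.644 − 1.645ν
  have hexp : 1.644 - 1.645 * ν ≤ (((L : ℝ)) ^ 2 / 3 - 1) * (eps1 L - lam2 / 2) / 4 := by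
    have e1 : (2 * Real.pi / (L : ℝ)) ^ 2 * (0.9997 - ν) / 2 ≤ eps1 L - lam2 / 2 := by rw [hνlam]; nlinarith
    have e2 : ((L : ℝ)) ^ 2 / 3 * 0.99981 ≤ ((L : ℝ)) ^ 2 / 3 - 1 := by nlinarith
    have e3 := mul_le_mul e2 e1 (by nlinarith) hnlo0
    have e4 : ((L : ℝ)) ^ 2 / 3 * 0.99981 * ((2 * Real.pi / (L : ℝ)) ^ 2 * (0.9997 - ν) / 2)
        = (((L : ℝ)) ^ 2 * (2 * Real.pi / L) ^ 2) * (0.99981 * (0.9997 - ν) / 6) := by ring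
    rw [e4, hVθ] at e3
    have hπ2 : 9.86902 ≤ Real.pi ^ 2 := by nlinarith
    have key : 4 * 9.86902 * (0.99981 * (0.9997 - ν) / 6) ≤ 4 * Real.pi ^ 2 * (0.99981 * (0.9997 - ν) / 6) :=
      mul_le_mul_of_nonneg_right (by linarith) (by nlinarith)
    linarith
  have hden : 0.9484 * (2 * Real.pi / (L : ℝ)) ^ 2 ≤ 2 * eps1 L - lam2 := by rw [hνlam]; nlinarith
  have hnum := exp_shell_le hexp hν0 hν1 exp_neg_1644 (by norm_num)
  exact div_le_div₀ (by positivity) hnum (by positivity) hden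

/-- ★ SHELL 2 (`|m₁| = |m₂| = 1`, `ε = 2ε₁`). [folklore] -/
theorem shell2_le (L : ℕ) [NeZero L] (hL : 128 ≤ L) {lam2 ν : ℝ} (hl0 : 0 < lam2)
    (hνlam : lam2 = ν * (2 * Real.pi / L) ^ 2) (hν0 : 0 ≤ ν) (hν1 : ν ≤ 0.0513)
    (n0 : ℕ) (hn0 : ((L : ℝ)) ^ 2 / 3 - 1 ≤ n0) {k : Tor L} (hk : k ≠ 0)
    (h2 : k.1.valMinAbs.natAbs = 1 ∧ k.2.valMinAbs.natAbs = 1) :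
    ((4 - epsT L k) / (4 - lam2 / 2)) ^ n0 * gres L lam2 k
      ≤ 0.037341 * (1 + 1.784 * ν) / (1.9481 * (2 * Real.pi / L) ^ 2) := by
  obtain ⟨hVθ, hV16, hθ2⟩ := size_facts L hL
  have hπ' := Real.pi_gt_d4
  have hε := eps1_ge_sharp L hL
  have hθpos : 0 < (2 * Real.pi / (L : ℝ)) ^ 2 := by
    have : (0 : ℝ) < L := by exact_mod_cast (show 0 < L by omega)
    positivity
  have hl1 : lam2 ≤ 1 := by rw [hνlam]; nlinarith
  have hεk : epsT L k = 2 * eps1 L := epsT_shellTwo L k h2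
  have hEl : lam2 / 2 < 2 * eps1 L := by rw [hνlam]; nlinarith
  have hgt := geom_term_le L hl0 hl1 hk (2 * eps1 L) hEl (le_of_eq hεk.symm) n0 _ hn0
  refine hgt.trans ?_
  have hnlo0 : 0 ≤ ((L : ℝ)) ^ 2 / 3 - 1 := by linarith
  have hexp : 3.288 - 1.645 * ν ≤ (((L : ℝ)) ^ 2 / 3 - 1) * (2 * eps1 L - lam2 / 2) / 4 := by
    have e1 : (2 * Real.pi / (L : ℝ)) ^ 2 * (0.9997 - ν / 2) ≤ 2 * eps1 L - lam2 / 2 := by rw [hνlam]; nlinarith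
    have e2 : ((L : ℝ)) ^ 2 / 3 * 0.99981 ≤ ((L : ℝ)) ^ 2 / 3 - 1 := by nlinarith
    have e3 := mul_le_mul e2 e1 (by nlinarith) hnlo0
    have e4 : ((L : ℝ)) ^ 2 / 3 * 0.99981 * ((2 * Real.pi / (L : ℝ)) ^ 2 * (0.9997 - ν / 2))
        = (((L : ℝ)) ^ 2 * (2 * Real.pi / L) ^ 2) * (0.99981 * (0.9997 - ν / 2) / 3) := by ring
    rw [e4, hVθ] at e3
    have hπ2 : 9.86902 ≤ Real.pi ^ 2 := by nlinarith
    have key : 4 * 9.86902 * (0.99981 * (0.9997 - ν / 2) / 3) ≤ 4 * Real.pi ^ 2 * (0.99981 * (0.9997 - ν / 2) / 3) :=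
      mul_le_mul_of_nonneg_right (by linarith) (by nlinarith)
    linarith
  have hden : 1.9481 * (2 * Real.pi / (L : ℝ)) ^ 2 ≤ 2 * (2 * eps1 L) - lam2 := by rw [hνlam]; nlinarith
  have hnum := exp_shell_le hexp hν0 hν1 exp_neg_3288 (by norm_num)
  exact div_le_div₀ (by positivity) hnum (by positivity) hden

/-- `s² ≤ |m|²` when one representative is at least `s` in absolute value. [folklore] -/
theorem repsq_ge {L : ℕ} (k : Tor L) (s : ℕ) (h : s ≤ k.1.valMinAbs.natAbs ∨ s ≤ k.2.valMinAbs.natAbs) :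
    ((s : ℝ)) ^ 2 ≤ (((k.1.valMinAbs : ℤ) : ℝ)) ^ 2 + (((k.2.valMinAbs : ℤ) : ℝ)) ^ 2 := by
  have h' : ((s : ℤ)) ^ 2 ≤ k.1.valMinAbs ^ 2 + k.2.valMinAbs ^ 2 := by
    rcases h with h | h
    · have h1 : ((s : ℤ)) ≤ (k.1.valMinAbs.natAbs : ℤ) := by exact_mod_cast h
      rw [Int.natCast_natAbs] at h1
      have := pow_le_pow_left₀ (by positivity) h1 2
      rw [sq_abs] at this; nlinarith [sq_nonneg k.2.valMinAbs]
    · have h1 : ((s : ℤ)) ≤ (k.2.valMinAbs.natAbs : ℤ) := by exact_mod_cast h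
      rw [Int.natCast_natAbs] at h1
      have := pow_le_pow_left₀ (by positivity) h1 2
      rw [sq_abs] at this; nlinarith [sq_nonneg k.1.valMinAbs]
  have := (Int.cast_le (R := ℝ)).mpr h'
  push_cast at this
  exact this

/-- ★ FAR, INNER REGION (`4 ≤ |m|²`, `|mᵢ| ≤ N₁`, `8N₁ ≤ L`). [folklore] -/
theorem far_inner_le (L : ℕ) [NeZero L] (hL : 128 ≤ L) {lam2 ν : ℝ} (hl0 : 0 < lam2)
    (hνlam : lam2 = ν * (2 * Real.pi / L) ^ 2) (hν1 : ν ≤ 0.0513)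
    (n0 : ℕ) (hn0 : ((L : ℝ)) ^ 2 / 3 - 1 ≤ n0) {k : Tor L} (hk : k ≠ 0) (N₁ : ℕ) (h8 : 8 * N₁ ≤ L)
    (hin : k.1.valMinAbs.natAbs ≤ N₁ ∧ k.2.valMinAbs.natAbs ≤ N₁)
    (hq4 : (4 : ℝ) ≤ (((k.1.valMinAbs : ℤ) : ℝ)) ^ 2 + (((k.2.valMinAbs : ℤ) : ℝ)) ^ 2) :
    ((4 - epsT L k) / (4 - lam2 / 2)) ^ n0 * gres L lam2 k
      ≤ Real.exp (-(1.52 * ((((k.1.valMinAbs : ℤ) : ℝ)) ^ 2 + (((k.2.valMinAbs : ℤ) : ℝ)) ^ 2)))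
        / (0.92717 * (2 * Real.pi / L) ^ 2 * ((((k.1.valMinAbs : ℤ) : ℝ)) ^ 2 + (((k.2.valMinAbs : ℤ) : ℝ)) ^ 2)) := by
  obtain ⟨hVθ, hV16, hθ2⟩ := size_facts L hL
  have hπ' := Real.pi_gt_d4
  have hθpos : 0 < (2 * Real.pi / (L : ℝ)) ^ 2 := by
    have : (0 : ℝ) < L := by exact_mod_cast (show 0 < L by omega)
    positivity
  set q : ℝ := (((k.1.valMinAbs : ℤ) : ℝ)) ^ 2 + (((k.2.valMinAbs : ℤ) : ℝ)) ^ 2 with hq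
  have hl1 : lam2 ≤ 1 := by rw [hνlam]; nlinarith
  have hE := epsT_ge_inner L k N₁ h8 hin.1 hin.2
  rw [← hq] at hE
  have hEl : lam2 / 2 < 0.47 * (2 * Real.pi / (L : ℝ)) ^ 2 * q := by rw [hνlam]; nlinarith
  have hgt := geom_term_le L hl0 hl1 hk _ hEl hE n0 _ hn0
  refine hgt.trans ?_
  have hnlo0 : 0 ≤ ((L : ℝ)) ^ 2 / 3 - 1 := by linarith
  have hexp : 1.52 * q ≤ (((L : ℝ)) ^ 2 / 3 - 1) * (0.47 * (2 * Real.pi / (L : ℝ)) ^ 2 * q - lam2 / 2) / 4 := by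
    have e1 : (2 * Real.pi / (L : ℝ)) ^ 2 * (0.47 * 0.9863 * q) ≤ 0.47 * (2 * Real.pi / (L : ℝ)) ^ 2 * q - lam2 / 2 := by
      rw [hνlam]; nlinarith
    have e2 : ((L : ℝ)) ^ 2 / 3 * 0.99981 ≤ ((L : ℝ)) ^ 2 / 3 - 1 := by nlinarith
    have e3 := mul_le_mul e2 e1 (by positivity) hnlo0
    have e4 : ((L : ℝ)) ^ 2 / 3 * 0.99981 * ((2 * Real.pi / (L : ℝ)) ^ 2 * (0.47 * 0.9863 * q))
        = (((L : ℝ)) ^ 2 * (2 * Real.pi / L) ^ 2) * (0.99981 * 0.47 * 0.9863 * q / 3) := by ring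
    rw [e4, hVθ] at e3
    have hπ2 : 9.86902 ≤ Real.pi ^ 2 := by nlinarith
    have hq0 : 0 ≤ q := by linarith
    have key : 4 * 9.86902 * (0.99981 * 0.47 * 0.9863 * q / 3) ≤ 4 * Real.pi ^ 2 * (0.99981 * 0.47 * 0.9863 * q / 3) :=
      mul_le_mul_of_nonneg_right (by linarith) (by positivity)
    linarith
  have hden : 0.92717 * (2 * Real.pi / (L : ℝ)) ^ 2 * q ≤ 2 * (0.47 * (2 * Real.pi / (L : ℝ)) ^ 2 * q) - lam2 := by
    rw [hνlam]; nlinarith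
  exact div_le_div₀ (Real.exp_pos _).le (Real.exp_le_exp.mpr (by linarith)) (by positivity) hden

/-- ★ FAR, OUTER REGION (`289 ≤ |m|²`). [folklore] -/
theorem far_outer_le (L : ℕ) [NeZero L] (hL : 128 ≤ L) {lam2 ν : ℝ} (hl0 : 0 < lam2)
    (hνlam : lam2 = ν * (2 * Real.pi / L) ^ 2) (hν1 : ν ≤ 0.0513)
    (n0 : ℕ) (hn0 : ((L : ℝ)) ^ 2 / 3 - 1 ≤ n0) {k : Tor L} (hk : k ≠ 0)
    (hq : (289 : ℝ) ≤ (((k.1.valMinAbs : ℤ) : ℝ)) ^ 2 + (((k.2.valMinAbs : ℤ) : ℝ)) ^ 2) :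
    ((4 - epsT L k) / (4 - lam2 / 2)) ^ n0 * gres L lam2 k
      ≤ Real.exp (-(0.657 * ((((k.1.valMinAbs : ℤ) : ℝ)) ^ 2 + (((k.2.valMinAbs : ℤ) : ℝ)) ^ 2)))
        / (0.3998 * (2 * Real.pi / L) ^ 2 * ((((k.1.valMinAbs : ℤ) : ℝ)) ^ 2 + (((k.2.valMinAbs : ℤ) : ℝ)) ^ 2)) := by
  obtain ⟨hVθ, hV16, hθ2⟩ := size_facts L hL
  have hπ' := Real.pi_gt_d4
  have hθpos : 0 < (2 * Real.pi / (L : ℝ)) ^ 2 := by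
    have : (0 : ℝ) < L := by exact_mod_cast (show 0 < L by omega)
    positivity
  set q : ℝ := (((k.1.valMinAbs : ℤ) : ℝ)) ^ 2 + (((k.2.valMinAbs : ℤ) : ℝ)) ^ 2 with hqdef
  have hl1 : lam2 ≤ 1 := by rw [hνlam]; nlinarith
  have hE := epsT_ge_outer L k
  rw [← hqdef] at hE
  have hEl : lam2 / 2 < 0.2 * (2 * Real.pi / (L : ℝ)) ^ 2 * q := by rw [hνlam]; nlinarith
  have hgt := geom_term_le L hl0 hl1 hk _ hEl hE n0 _ hn0
  refine hgt.trans ?_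
  have hnlo0 : 0 ≤ ((L : ℝ)) ^ 2 / 3 - 1 := by linarith
  have hexp : 0.657 * q ≤ (((L : ℝ)) ^ 2 / 3 - 1) * (0.2 * (2 * Real.pi / (L : ℝ)) ^ 2 * q - lam2 / 2) / 4 := by
    have e1 : (2 * Real.pi / (L : ℝ)) ^ 2 * (0.2 * 0.9995 * q) ≤ 0.2 * (2 * Real.pi / (L : ℝ)) ^ 2 * q - lam2 / 2 := by
      rw [hνlam]; nlinarith
    have e2 : ((L : ℝ)) ^ 2 / 3 * 0.99981 ≤ ((L : ℝ)) ^ 2 / 3 - 1 := by nlinarith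
    have e3 := mul_le_mul e2 e1 (by positivity) hnlo0
    have e4 : ((L : ℝ)) ^ 2 / 3 * 0.99981 * ((2 * Real.pi / (L : ℝ)) ^ 2 * (0.2 * 0.9995 * q))
        = (((L : ℝ)) ^ 2 * (2 * Real.pi / L) ^ 2) * (0.99981 * 0.2 * 0.9995 * q / 3) := by ring
    rw [e4, hVθ] at e3
    have hπ2 : 9.86902 ≤ Real.pi ^ 2 := by nlinarith
    have hq0 : 0 ≤ q := by linarith
    have key : 4 * 9.86902 * (0.99981 * 0.2 * 0.9995 * q / 3) ≤ 4 * Real.pi ^ 2 * (0.99981 * 0.2 * 0.9995 * q / 3) :=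
      mul_le_mul_of_nonneg_right (by linarith) (by positivity)
    linarith
  have hden : 0.3998 * (2 * Real.pi / (L : ℝ)) ^ 2 * q ≤ 2 * (0.2 * (2 * Real.pi / (L : ℝ)) ^ 2 * q) - lam2 := by
    rw [hνlam]; nlinarith
  exact div_le_div₀ (Real.exp_pos _).le (Real.exp_le_exp.mpr (by linarith)) (by positivity) hden

end RowC

end Summit.HubbardSuperconductivity.HubbardSuperconductivity.Theorems.AnisotropyChord.Transfer.Fibre3

end
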